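import Literature.Probability.RandomPlanarGeometry.SAWWidePolygonsJoin
import Mathlib.Algebra.Order.Chebyshev
import HarnessLib

/-!
# DGHM20 Lemma 3.3, joining step: `J(p, τ(q))` determines `(p, q)`; the counting inequality

Topic `Literature/Probability/RandomPlanarGeometry` (continues `SAWWidePolygonsJoin.lean`).

Source: H. Duminil-Copin, S. Ganguly, A. Hammond, I. Manolescu, *Bounding the number of
self-avoiding walks: Hammersley–Welsh with polygon insertion*, Ann. Probab. 48 (2020),
arXiv:1809.00760, proof of Lemma 3.3: "Note that `J(p,τ(q))` determines `(p,q)` … This injectivity on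
the part of `J` implies that `|WSAP^u_{4m+4}| ≥ Σ_{j=-⌈u⌉}^{⌊u⌋} |{p ∈ WSAP-bar^u_{2m+2} : y(ne(p)) = j}|²`
… This right-hand side is seen to be at least `(2u+1)^{-1} |WSAP-bar^u_{2m+2}|²` by means of the
Cauchy-Schwarz inequality."

## Contents (namespace `Literature.Probability.RandomPlanarGeometry.SAW`), all PROVED

* `leftPart J k` / `rightPart J k` — the edges of `J` weakly left / strictly right of the column
  `x = k`; `leftPart_dghmJoin` (`= p` minus the plaquette's west side), `rightPart_dghmJoin`;
* `recoverP`, `recoverQ` with `recoverP_dghmJoin`, `recoverQ_dghmJoin` — any translate of the join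
  together with the position of `EN(p)` gives back `p` and `q`;
* `joinCode`, `eq_of_joinCode_eq` — the LOSSY injectivity `(p,q) ↦ (normalise J, position of EN(p))`
  (the source's sharper cut-line argument is not formalised; the loss is the factor `(4M+1)²`);
* **`sq_card_le_card_widePolygons`** — for a set `P` of normal `M`-gons with `width ≥ w`,
  `height ≤ h`, and `u ≤ 2w+1`, `2h ≤ 16u`: `|P|² ≤ (2h+1) · (4M+1)² · |WSAP^u_{2M}|`.
-/

noncomputable section

open Finset SimpleGraph Literature.Probability.LatticeModels Literature.Probability.Percolation
open Literature.Barriers.CriticalPhenomena.SupercriticalSAW (shiftEdges isPolygon_shiftEdges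
  card_shiftEdges mem_shiftEdges_iff shiftEdges_injective)
open Literature.Probability.Percolation.SiteGadgetSystem (vertsOf mem_vertsOf)

namespace Literature.Probability.RandomPlanarGeometry.SAW

section Determine

variable {p q : Finset (Sym2 (Site 2))}

/-! ### `J` and the column of `EN(p)` determine `p` and `q` -/

open Classical in
/-- The edges of `J` weakly left of the column `x = k`. [cite: DuminilCopinGangulyHammondManolescu2020, §3.1 (proof of Lemma 3.3: "J(p,τ(q)) determines (p,q)")] -/
def leftPart (J : Finset (Sym2 (Site 2))) (k : ℤ) : Finset (Sym2 (Site 2)) :=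
  J.filter fun e => ∀ v ∈ e, v 0 ≤ k

open Classical in
/-- The edges of `J` strictly right of the column `x = k`. [cite: DuminilCopinGangulyHammondManolescu2020, §3.1 (proof of Lemma 3.3)] -/
def rightPart (J : Finset (Sym2 (Site 2))) (k : ℤ) : Finset (Sym2 (Site 2)) :=
  J.filter fun e => ∀ v ∈ e, k < v 0

/-- Membership in `leftPart`. [cite: DuminilCopinGangulyHammondManolescu2020, §3.1 (proof of Lemma 3.3)] -/
theorem mem_leftPart {J : Finset (Sym2 (Site 2))} {k : ℤ} {e : Sym2 (Site 2)} :
    e ∈ leftPart J k ↔ e ∈ J ∧ ∀ v ∈ e, v 0 ≤ k := by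
  classical
  exact Finset.mem_filter

/-- Membership in `rightPart`. [cite: DuminilCopinGangulyHammondManolescu2020, §3.1 (proof of Lemma 3.3)] -/
theorem mem_rightPart {J : Finset (Sym2 (Site 2))} {k : ℤ} {e : Sym2 (Site 2)} :
    e ∈ rightPart J k ↔ e ∈ J ∧ ∀ v ∈ e, k < v 0 := by
  classical
  exact Finset.mem_filter

/-- `leftPart` commutes with translation. [cite: DuminilCopinGangulyHammondManolescu2020, §3.1 (proof of Lemma 3.3)] -/
theorem leftPart_shiftEdges (t : Site 2) (J : Finset (Sym2 (Site 2))) (k : ℤ) :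
    leftPart (shiftEdges t J) (k + t 0) = shiftEdges t (leftPart J k) := by
  ext e
  simp only [mem_leftPart, mem_shiftEdges_iff]
  constructor
  · rintro ⟨⟨e', he', rfl⟩, hv⟩
    refine ⟨e', ⟨he', fun v hv' => ?_⟩, rfl⟩
    have := hv (v + t) (Sym2.mem_map.2 ⟨v, hv', rfl⟩)
    simp only [Pi.add_apply] at this; linarith
  · rintro ⟨e', ⟨he', hv⟩, rfl⟩
    refine ⟨⟨e', he', rfl⟩, fun v hv' => ?_⟩
    obtain ⟨w, hw, rfl⟩ := Sym2.mem_map.1 hv'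
    simp only [Pi.add_apply]; linarith [hv w hw]

/-- `rightPart` commutes with translation. [cite: DuminilCopinGangulyHammondManolescu2020, §3.1 (proof of Lemma 3.3)] -/
theorem rightPart_shiftEdges (t : Site 2) (J : Finset (Sym2 (Site 2))) (k : ℤ) :
    rightPart (shiftEdges t J) (k + t 0) = shiftEdges t (rightPart J k) := by
  ext e
  simp only [mem_rightPart, mem_shiftEdges_iff]
  constructor
  · rintro ⟨⟨e', he', rfl⟩, hv⟩
    refine ⟨e', ⟨he', fun v hv' => ?_⟩, rfl⟩
    have := hv (v + t) (Sym2.mem_map.2 ⟨v, hv', rfl⟩)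
    simp only [Pi.add_apply] at this; linarith
  · rintro ⟨e', ⟨he', hv⟩, rfl⟩
    refine ⟨⟨e', he', rfl⟩, fun v hv' => ?_⟩
    obtain ⟨w, hw, rfl⟩ := Sym2.mem_map.1 hv'
    simp only [Pi.add_apply]; linarith [hv w hw]

/-- Every edge has an endpoint. [folklore] -/
private theorem exists_mem_sym2 (e : Sym2 (Site 2)) : ∃ v, v ∈ e := by
  induction e using Sym2.ind with
  | _ x y => exact ⟨x, Sym2.mem_mk_left x y⟩

/-- **The part of `J(p, τ(q))` left of the column of `EN(p)` is `p` minus the plaquette's west side.**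
[cite: DuminilCopinGangulyHammondManolescu2020, §3.1 (proof of Lemma 3.3: "J(p,τ(q)) determines (p,q)")] -/
theorem leftPart_dghmJoin (hp : IsPolygon (zdGraph 2) p) (hq : IsPolygon (zdGraph 2) q) :
    leftPart (dghmJoin p q) (enV p 0) = p.erase s(enV p, enV p - ey) := by
  have hpn := hp.vertsOf_nonempty
  have hqn := hq.vertsOf_nonempty
  ext e
  rw [mem_leftPart, dghmJoin]
  constructor
  · rintro ⟨he, hv⟩
    simp only [Finset.mem_union, Finset.mem_singleton] at he
    rcases he with (he | he) | (rfl | rfl)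
    · exact he
    · exfalso
      obtain ⟨v, hve⟩ := exists_mem_sym2 e
      have h1 := hv v hve
      have h2 := lt_apply_zero_of_mem_vertsOf_qImage (p := p) hqn
        (mem_verts_of_mem (Finset.mem_of_mem_erase he) hve)
      linarith
    · have := hv (enV p + ex) (Sym2.mem_mk_right _ _); simp at this
    · have := hv (enV p + ex - ey) (Sym2.mem_mk_right _ _); simp at this
  · intro he
    refine ⟨Finset.mem_union_left _ (Finset.mem_union_left _ he), fun v hv => ?_⟩
    exact apply_zero_le_of_mem_vertsOf hpn (mem_verts_of_mem (Finset.mem_of_mem_erase he) hv)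

/-- **The part of `J(p, τ(q))` right of the column of `EN(p)` is the copy of `q` minus the plaquette's
east side.** [cite: DuminilCopinGangulyHammondManolescu2020, §3.1 (proof of Lemma 3.3)] -/
theorem rightPart_dghmJoin (hp : IsPolygon (zdGraph 2) p) (hq : IsPolygon (zdGraph 2) q) :
    rightPart (dghmJoin p q) (enV p 0) = (qImage p q).erase s(enV p + ex, enV p + ex - ey) := by
  have hpn := hp.vertsOf_nonempty
  have hqn := hq.vertsOf_nonempty
  ext e
  rw [mem_rightPart, dghmJoin]
  constructor
  · rintro ⟨he, hv⟩
    simp only [Finset.mem_union, Finset.mem_singleton] at he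
    rcases he with (he | he) | (rfl | rfl)
    · exfalso
      obtain ⟨v, hve⟩ := exists_mem_sym2 e
      have h1 := hv v hve
      have h2 := apply_zero_le_of_mem_vertsOf hpn (mem_verts_of_mem (Finset.mem_of_mem_erase he) hve)
      linarith
    · exact he
    · have := hv (enV p) (Sym2.mem_mk_left _ _); simp at this
    · have := hv (enV p - ey) (Sym2.mem_mk_left _ _); simp at this
  · intro he
    refine ⟨Finset.mem_union_left _ (Finset.mem_union_right _ he), fun v hv => ?_⟩
    exact lt_apply_zero_of_mem_vertsOf_qImage hqn (mem_verts_of_mem (Finset.mem_of_mem_erase he) hv)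

/-- Reconstruction of `p` from (a translate of) the join and the position of `EN(p)`.
[cite: DuminilCopinGangulyHammondManolescu2020, §3.1 (proof of Lemma 3.3)] -/
def recoverP (J : Finset (Sym2 (Site 2))) (a : Site 2) : Finset (Sym2 (Site 2)) :=
  normalise (insert s(a, a - ey) (leftPart J (a 0)))

/-- Reconstruction of `q` from (a translate of) the join and the position of `EN(p)`.
[cite: DuminilCopinGangulyHammondManolescu2020, §3.1 (proof of Lemma 3.3)] -/
def recoverQ (J : Finset (Sym2 (Site 2))) (a : Site 2) : Finset (Sym2 (Site 2)) :=
  normalise (reflEdges 0 (insert s(a + ex, a + ex - ey) (rightPart J (a 0))))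

/-- Translating an `insert`. [cite: DuminilCopinGangulyHammondManolescu2020, §3.1 (polygons up to translation)] -/
theorem shiftEdges_insert (t : Site 2) (e : Sym2 (Site 2)) (X : Finset (Sym2 (Site 2))) :
    shiftEdges t (insert e X) = insert (Sym2.map (fun v => v + t) e) (shiftEdges t X) := by
  rw [shiftEdges, Finset.image_insert]; rfl

/-- **`J(p, τ(q))`, up to translation, together with the position of `EN(p)` determines `p`.**
[cite: DuminilCopinGangulyHammondManolescu2020, §3.1 (proof of Lemma 3.3: "J(p,τ(q)) determines (p,q)")] -/
theorem recoverP_dghmJoin (hp : IsPolygon (zdGraph 2) p) (hq : IsPolygon (zdGraph 2) q)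
    (hpN : IsNormal p) (t : Site 2) :
    recoverP (shiftEdges t (dghmJoin p q)) (enV p + t) = p := by
  have hab : s(enV p, enV p - ey) ∈ p := edge_down_mem_of_isEN hp (isEN_enV hp.vertsOf_nonempty)
  rw [recoverP, Pi.add_apply, leftPart_shiftEdges, leftPart_dghmJoin hp hq]
  have : s(enV p + t, enV p + t - ey) = Sym2.map (fun v => v + t) s(enV p, enV p - ey) := by
    rw [Sym2.map_mk]; congr 1; abel
  rw [this, ← shiftEdges_insert, Finset.insert_erase hab, normalise_shiftEdges, normalise_eq_self hpN]

/-- **`J(p, τ(q))`, up to translation, together with the position of `EN(p)` determines `q`.**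
[cite: DuminilCopinGangulyHammondManolescu2020, §3.1 (proof of Lemma 3.3: "J(p,τ(q)) determines (p,q)")] -/
theorem recoverQ_dghmJoin (hp : IsPolygon (zdGraph 2) p) (hq : IsPolygon (zdGraph 2) q)
    (hqN : IsNormal q) (t : Site 2) :
    recoverQ (shiftEdges t (dghmJoin p q)) (enV p + t) = q := by
  have hcd : s(enV p + ex, enV p + ex - ey) ∈ qImage p q :=
    edge_down_mem_of_isWN (isPolygon_qImage p hq).1 (isWN_qImage p hq.vertsOf_nonempty)
  rw [recoverQ, Pi.add_apply, rightPart_shiftEdges, rightPart_dghmJoin hp hq]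
  have : s(enV p + t + ex, enV p + t + ex - ey) = Sym2.map (fun v => v + t) s(enV p + ex, enV p + ex - ey) := by
    rw [Sym2.map_mk]; congr 1 <;> abel
  rw [this, ← shiftEdges_insert, Finset.insert_erase hcd, qImage, shiftEdges_shiftEdges,
    normalise_reflEdges_shiftEdges, reflEdges_reflEdges, normalise_eq_self hqN]

end Determine

/-! ### Counting: `|P|² ≤ (2h+1)(4M+1)² |WSAP^u_{2M}|` -/

section Count

variable {p q : Finset (Sym2 (Site 2))}

/-- The normalising shift as a total function (junk `0` without vertices).
[cite: DuminilCopinGangulyHammondManolescu2020, §3.1 (polygons up to translation)] -/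
def nshift (E : Finset (Sym2 (Site 2))) : Site 2 :=
  if h : (vertsOf E).Nonempty then normShift E h else 0

/-- `normalise E = E + nshift E`. [cite: DuminilCopinGangulyHammondManolescu2020, §3.1 (polygons up to translation)] -/
theorem normalise_eq_shiftEdges_nshift (E : Finset (Sym2 (Site 2))) :
    normalise E = shiftEdges (nshift E) E := by
  by_cases h : (vertsOf E).Nonempty
  · rw [nshift, dif_pos h, normalise_eq E h]
  · rw [nshift, dif_neg h, normalise, dif_neg h, shiftEdges_zero]

/-- **The join of two admissible polygons is a wide polygon**: for normal `M`-gons `p, q` with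
`width ≥ w`, `height ≤ h`, equal `relHeight`, and `u ≤ 2w + 1`, `2h ≤ 16u`, the class of
`J(p, τ(q))` lies in `WSAP^u_{2M}`. [cite: DuminilCopinGangulyHammondManolescu2020, §3.1 (proof of Lemma 3.3: "J(p,τ(q)) belongs to WSAP^u_{4m+4}")] -/
theorem normalise_dghmJoin_mem_widePolygons {M w h u : ℕ} (hp : p ∈ normPolygons M)
    (hq : q ∈ normPolygons M) (hw₁ : HasWidthGe p w) (hw₂ : HasWidthGe q w) (hh₁ : HasHeightLe p h)
    (hh₂ : HasHeightLe q h) (hrel : relHeight p = relHeight q) (hu : u ≤ 2 * w + 1)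
    (hh : 2 * h ≤ 16 * u) : normalise (dghmJoin p q) ∈ widePolygons u (2 * M) := by
  obtain ⟨hpP, hpc, -⟩ := mem_normPolygons.1 hp
  obtain ⟨hqP, hqc, -⟩ := mem_normPolygons.1 hq
  obtain ⟨hJ, hJc⟩ := isPolygon_dghmJoin hpP hqP
  rw [mem_widePolygons, normalise_eq_shiftEdges_nshift]
  refine ⟨isPolygon_shiftEdges hJ _, by rw [card_shiftEdges, hJc, hpc, hqc]; ring, ?_, ?_, ?_⟩
  · rw [← normalise_eq_shiftEdges_nshift]; exact isNormal_normalise hJ.vertsOf_nonempty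
  · rw [hasLWidthGe_shiftEdges_iff]
    exact (hasLWidthGe_dghmJoin hpP hqP hrel hw₁ hw₂).anti (by omega)
  · rw [hasHeightLe_shiftEdges_iff]
    exact (hasHeightLe_dghmJoin hpP hqP hh₁ hh₂).mono (by omega)

/-- The code of a pair: the class of the join and the position of `EN(p)` in its normal translate.
[cite: DuminilCopinGangulyHammondManolescu2020, §3.1 (proof of Lemma 3.3: "this injectivity on the part of J")] -/
def joinCode (pq : Finset (Sym2 (Site 2)) × Finset (Sym2 (Site 2))) : Finset (Sym2 (Site 2)) × Site 2 :=
  (normalise (dghmJoin pq.1 pq.2), enV pq.1 + nshift (dghmJoin pq.1 pq.2))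

/-- **Injectivity (lossy form): the code determines the pair.**
[cite: DuminilCopinGangulyHammondManolescu2020, §3.1 (proof of Lemma 3.3: "J(p,τ(q)) determines (p,q)")] -/
theorem eq_of_joinCode_eq {p q p' q' : Finset (Sym2 (Site 2))} (hp : IsPolygon (zdGraph 2) p)
    (hq : IsPolygon (zdGraph 2) q) (hp' : IsPolygon (zdGraph 2) p') (hq' : IsPolygon (zdGraph 2) q')
    (hpN : IsNormal p) (hqN : IsNormal q) (hp'N : IsNormal p') (hq'N : IsNormal q')
    (h : joinCode (p, q) = joinCode (p', q')) : p = p' ∧ q = q' := by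
  simp only [joinCode, Prod.mk.injEq, normalise_eq_shiftEdges_nshift] at h
  obtain ⟨h1, h2⟩ := h
  constructor
  · rw [← recoverP_dghmJoin hp hq hpN (nshift (dghmJoin p q)), h1, h2, recoverP_dghmJoin hp' hq' hp'N]
  · rw [← recoverQ_dghmJoin hp hq hqN (nshift (dghmJoin p q)), h1, h2, recoverQ_dghmJoin hp' hq' hq'N]

/-- The recorded position lies in the box `[-2M, 2M]²` (indeed in `[0, 2M]²`).
[cite: DuminilCopinGangulyHammondManolescu2020, §3.1 (proof of Lemma 3.3)] -/
theorem joinCode_snd_mem_box {M : ℕ} (hp : p ∈ normPolygons M) (hq : q ∈ normPolygons M) :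
    (joinCode (p, q)).2 ∈ box 2 (2 * M) := by
  obtain ⟨hpP, hpc, -⟩ := mem_normPolygons.1 hp
  obtain ⟨hqP, hqc, -⟩ := mem_normPolygons.1 hq
  obtain ⟨hJ, hJc⟩ := isPolygon_dghmJoin hpP hqP
  have hmem : enV p + nshift (dghmJoin p q) ∈ vertsOf (shiftEdges (nshift (dghmJoin p q)) (dghmJoin p q)) :=
    add_mem_vertsOf_shiftEdges.2 (vertsOf_subset_vertsOf_dghmJoin hpP (isEN_enV hpP.vertsOf_nonempty).1)
  have hN : IsNormal (shiftEdges (nshift (dghmJoin p q)) (dghmJoin p q)) := by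
    rw [← normalise_eq_shiftEdges_nshift]; exact isNormal_normalise hJ.vertsOf_nonempty
  have hcard : (shiftEdges (nshift (dghmJoin p q)) (dghmJoin p q)).card = 2 * M := by
    rw [card_shiftEdges, hJc, hpc, hqc]; ring
  rw [mem_box]
  intro i
  have := coord_mem_Icc_of_isNormal (isPolygon_shiftEdges hJ _) hN hmem i
  rw [hcard] at this
  simp only [joinCode]
  push_cast at this ⊢
  constructor <;> linarith [this.1, this.2]

/-- `relHeight` of a polygon of height `≤ h` lies in `[-h, h]`.
[cite: DuminilCopinGangulyHammondManolescu2020, §3.1 (proof of Lemma 3.3: "Σ_{j=-⌈u⌉}^{⌊u⌋}")] -/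
theorem relHeight_mem_Icc (hp : IsPolygon (zdGraph 2) p) {h : ℕ} (hh : HasHeightLe p h) :
    relHeight p ∈ Finset.Icc (-(h : ℤ)) h := by
  have hpn := hp.vertsOf_nonempty
  have h1 := hh (enV p) (isEN_enV hpn).1 (wsV p) (isWS_wsV hpn).1
  have h2 := hh (wsV p) (isWS_wsV hpn).1 (enV p) (isEN_enV hpn).1
  rw [Finset.mem_Icc, relHeight]
  constructor <;> linarith

/-- Cauchy–Schwarz over fibres: the number of ordered pairs with equal label is at least
`|P|² / #labels`. [folklore] -/
private theorem card_sq_le_card_mul_card_pairs {α β : Type*} [DecidableEq α] [DecidableEq β]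
    (P : Finset α) (f : α → β) (T : Finset β) (hT : ∀ p ∈ P, f p ∈ T) :
    P.card ^ 2 ≤ T.card * ((P ×ˢ P).filter fun pq => f pq.1 = f pq.2).card := by
  have hPsum : P.card = ∑ j ∈ T, (P.filter fun p => f p = j).card :=
    Finset.card_eq_sum_card_fiberwise hT
  have hSsum : ((P ×ˢ P).filter fun pq => f pq.1 = f pq.2).card =
      ∑ j ∈ T, (P.filter fun p => f p = j).card ^ 2 := by
    have hmap : ∀ pq ∈ (P ×ˢ P).filter (fun pq => f pq.1 = f pq.2), f pq.1 ∈ T := fun pq hpq =>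
      hT pq.1 (Finset.mem_product.1 (Finset.mem_filter.1 hpq).1).1
    rw [Finset.card_eq_sum_card_fiberwise hmap]
    refine Finset.sum_congr rfl fun j _ => ?_
    have : ((P ×ˢ P).filter (fun pq => f pq.1 = f pq.2)).filter (fun pq => f pq.1 = j) =
        (P.filter fun p => f p = j) ×ˢ (P.filter fun p => f p = j) := by
      ext ⟨a, b⟩
      simp only [Finset.mem_filter, Finset.mem_product]
      constructor
      · rintro ⟨⟨⟨ha, hb⟩, hab⟩, hj⟩; exact ⟨⟨ha, hj⟩, hb, by rw [← hab, hj]⟩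
      · rintro ⟨⟨ha, hj⟩, hb, hj'⟩; exact ⟨⟨⟨ha, hb⟩, by rw [hj, hj']⟩, hj⟩
    rw [this, Finset.card_product, sq]
  rw [hPsum, hSsum]
  exact sq_sum_le_card_mul_sum_sq

/-- **DGHM20 Lemma 3.3, the joining inequality (lossy form).** For a set `P` of normal `M`-gons of
width `≥ w` and height `≤ h`, with `u ≤ 2w+1` and `2h ≤ 16u`:
`|P|² ≤ (2h+1) · (4M+1)² · |WSAP^u_{2M}|`. (Source: `|WSAP^u_{4m+4}| ≥ Σ_j |{p : y(EN(p)) = j}|²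
≥ (2u+1)^{-1} |P|²` for `P` = the `(2m+2)`-gons with `width ≥ u/2`, `height ≤ u`; the extra factor
`(4M+1)²` is the price of the lossy injectivity `(p,q) ↦ (J, EN(p))`.)
[cite: DuminilCopinGangulyHammondManolescu2020, Lemma 3.3 (proof, joining step and Cauchy–Schwarz)] -/
theorem sq_card_le_card_widePolygons {M w h u : ℕ} (P : Finset (Finset (Sym2 (Site 2))))
    (hP : ∀ p ∈ P, p ∈ normPolygons M ∧ HasWidthGe p w ∧ HasHeightLe p h)
    (hu : u ≤ 2 * w + 1) (hh : 2 * h ≤ 16 * u) :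
    P.card ^ 2 ≤ (2 * h + 1) * (4 * M + 1) ^ 2 * (widePolygons u (2 * M)).card := by
  classical
  -- (1) the pairs with equal `relHeight` inject into `WSAP × box`
  have h1 : ((P ×ˢ P).filter fun pq => relHeight pq.1 = relHeight pq.2).card ≤
      (widePolygons u (2 * M)).card * (4 * M + 1) ^ 2 := by
    have hmaps : ∀ pq ∈ (P ×ˢ P).filter (fun pq => relHeight pq.1 = relHeight pq.2),
        joinCode pq ∈ widePolygons u (2 * M) ×ˢ box 2 (2 * M) := by
      rintro ⟨p, q⟩ hpq
      obtain ⟨hpq, hrel⟩ := Finset.mem_filter.1 hpq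
      obtain ⟨hp, hq⟩ := Finset.mem_product.1 hpq
      obtain ⟨hp1, hp2, hp3⟩ := hP p hp
      obtain ⟨hq1, hq2, hq3⟩ := hP q hq
      exact Finset.mem_product.2
        ⟨normalise_dghmJoin_mem_widePolygons hp1 hq1 hp2 hq2 hp3 hq3 hrel hu hh, joinCode_snd_mem_box hp1 hq1⟩
    have hinj : Set.InjOn joinCode ↑((P ×ˢ P).filter fun pq => relHeight pq.1 = relHeight pq.2) := by
      rintro ⟨p, q⟩ hpq ⟨p', q'⟩ hpq' heq
      obtain ⟨hp, hq⟩ := Finset.mem_product.1 (Finset.mem_filter.1 (Finset.mem_coe.1 hpq)).1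
      obtain ⟨hp', hq'⟩ := Finset.mem_product.1 (Finset.mem_filter.1 (Finset.mem_coe.1 hpq')).1
      obtain ⟨hpP, -, hpN⟩ := mem_normPolygons.1 (hP p hp).1
      obtain ⟨hqP, -, hqN⟩ := mem_normPolygons.1 (hP q hq).1
      obtain ⟨hp'P, -, hp'N⟩ := mem_normPolygons.1 (hP p' hp').1
      obtain ⟨hq'P, -, hq'N⟩ := mem_normPolygons.1 (hP q' hq').1
      obtain ⟨h₁, h₂⟩ := eq_of_joinCode_eq hpP hqP hp'P hq'P hpN hqN hp'N hq'N heq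
      rw [h₁, h₂]
    calc ((P ×ˢ P).filter fun pq => relHeight pq.1 = relHeight pq.2).card
        ≤ (widePolygons u (2 * M) ×ˢ box 2 (2 * M)).card := Finset.card_le_card_of_injOn _ hmaps hinj
      _ = (widePolygons u (2 * M)).card * (4 * M + 1) ^ 2 := by
          rw [Finset.card_product, card_box]; ring
  -- (2) Cauchy–Schwarz over the `2h+1` values of `relHeight`
  have hfib : ∀ p ∈ P, relHeight p ∈ Finset.Icc (-(h : ℤ)) h := fun p hp =>
    relHeight_mem_Icc (mem_normPolygons.1 (hP p hp).1).1 (hP p hp).2.2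
  have hT : (Finset.Icc (-(h : ℤ)) h).card = 2 * h + 1 := by
    rw [Int.card_Icc]; omega
  have h2 := card_sq_le_card_mul_card_pairs P relHeight _ hfib
  rw [hT] at h2
  calc P.card ^ 2 ≤ (2 * h + 1) * ((P ×ˢ P).filter fun pq => relHeight pq.1 = relHeight pq.2).card := h2
    _ ≤ (2 * h + 1) * ((widePolygons u (2 * M)).card * (4 * M + 1) ^ 2) := Nat.mul_le_mul_left _ h1
    _ = (2 * h + 1) * (4 * M + 1) ^ 2 * (widePolygons u (2 * M)).card := by ring

end Count

end Literature.Probability.RandomPlanarGeometry.SAW
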